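import Mathlib
import HarnessLib
import Summits.CriticalPhenomena.PercolationContinuityZ3.Theses.PercTreeValue
import Summits.CriticalPhenomena.PercolationContinuityZ3.Theorems.PercTreeValueTetrahedronDisjointCoexistenceStubRestrictProduct
import Summits.CriticalPhenomena.PercolationContinuityZ3.Theorems.PercTreeValueTetrahedronDisjointCoexistenceStubConfineProduct
import Literature.Probability.Percolation.InequalitiesProofs
import Literature.Probability.Percolation.RSW
import Literature.Probability.Percolation.LatticeWalksGM

/-!
# `stub_shellOfSixWalls` of line `Sketch` (crux `TetrahedronDisjointCoexistence`,
# stmt-CriticalPhenomena-7798): Kesten's six walls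

Registered stub `stub_shellOfSixWalls` (S7, off-path) of the lead's skeleton
`Cruxes/TetrahedronDisjointCoexistence/Lines/Sketch.lean`, landed DEF-FREE over tree declarations.

For boxes `R = Icc lo hi ⊆ R' = Icc lo' hi'` of `ℤ³` with `lo' < lo`, `hi < hi'` coordinatewise, the
shell event `Shell(R, R')` = "no open path of the annulus `R' ∖ R` from a vertex adjacent to `R` to
a vertex adjacent to `R'ᶜ`" has probability at least `∏ᵢ (1 - P(Tᵢ)) (1 - P(Bᵢ))`, where `Tᵢ`
(resp. `Bᵢ`) is the event that the top (resp. bottom) wall of `R' ∖ R` in direction `i`,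
`R' ∩ {hi i + 1 ≤ zᵢ}` (resp. `R' ∩ {zᵢ ≤ lo i - 1}`), is crossed by an open path in its thin
direction.

Proof.
* Pointwise, on lattice configurations `ω ⊆ E(ℤ³)` (`P`-a.e., `real_preimage_inter_edgeSet`):
  if an open path `π` of `R' ∖ R` joins `u` (adjacent to `R`) to `w` (adjacent to some
  `z' ∉ R'`), then for some coordinate `i` either `w i = hi' i` or `w i = lo' i` (lattice
  neighbours differ by one in one coordinate). In the first case `u i ≤ hi i + 1 ≤ w i`, and the
  piece of `π` after its last visit to the level `{zᵢ = hi i + 1}`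
  (`exists_openConnIn_ge_level`) crosses the top wall; the second case is symmetric
  (`exists_openConnIn_le_level`). Hence `⋂ᵢ (Tᵢᶜ ∩ Bᵢᶜ) ⊆ Shell(R, R')` a.e.
* The six crossing events are increasing and measurable, so their complements are decreasing and
  Harris–FKG (`harris_fkg_lower`, iterated over `Fin 3`) gives
  `∏ᵢ (1 - P(Tᵢ)) (1 - P(Bᵢ)) ≤ P(⋂ᵢ (Tᵢᶜ ∩ Bᵢᶜ))`.
-/

noncomputable section

namespace Summit.CriticalPhenomena.PercolationContinuityZ3.Theorems.TetrahedronDisjointCoexistence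

open MeasureTheory
open Literature.Probability.Percolation Literature.Probability.LatticeModels

variable {V : Type*}

/-! ### Harris–FKG for finitely many decreasing events -/

/-- **Harris for finitely many decreasing events** under `P_p`: `∏ₖ P(Dₖ) ≤ P(⋂ₖ Dₖ)`
(`harris_fkg_lower`, by induction on the finite index set). -/
theorem sixWalls_prod_real_le_biInter {κ : Type*} (G : SimpleGraph V) (p : unitInterval)
    (s : Finset κ) {D : κ → Set (BondConfig V)} (hD : ∀ k ∈ s, IsLowerSet (D k))
    (hDm : ∀ k ∈ s, MeasurableSet (D k)) :
    ∏ k ∈ s, (bondPercolation G p).real (D k) ≤ (bondPercolation G p).real (⋂ k ∈ s, D k) := by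
  classical
  induction s using Finset.induction_on with
  | empty => simp
  | insert a s ha ih =>
    rw [Finset.prod_insert ha, Finset.set_biInter_insert]
    have hs : ∀ k ∈ s, k ∈ insert a s := fun k hk => Finset.mem_insert_of_mem hk
    refine le_trans (mul_le_mul_of_nonneg_left (ih (fun k hk => hD k (hs k hk))
      (fun k hk => hDm k (hs k hk))) measureReal_nonneg) ?_
    exact harris_fkg_lower G p (hD a (Finset.mem_insert_self a s))
      (isLowerSet_iInter₂ fun k hk => hD k (hs k hk)) (hDm a (Finset.mem_insert_self a s))
      (Finset.measurableSet_biInter s fun k hk => hDm k (hs k hk))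

/-- **Harris for finitely many pairs of increasing events, complemented**:
`∏ₖ (1 - P(Tₖ)) (1 - P(Bₖ)) ≤ P(no Tₖ and no Bₖ occurs)`. -/
theorem sixWalls_prod_one_sub_mul_le {κ : Type*} [Fintype κ] (G : SimpleGraph V) (p : unitInterval)
    {T B : κ → Set (BondConfig V)} (hT : ∀ k, IsUpperSet (T k)) (hB : ∀ k, IsUpperSet (B k))
    (hTm : ∀ k, MeasurableSet (T k)) (hBm : ∀ k, MeasurableSet (B k)) :
    ∏ k, (1 - (bondPercolation G p).real (T k)) * (1 - (bondPercolation G p).real (B k)) ≤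
      (bondPercolation G p).real {ω | ∀ k, ω ∉ T k ∧ ω ∉ B k} := by
  have h1 : ∀ k, (1 - (bondPercolation G p).real (T k)) * (1 - (bondPercolation G p).real (B k)) ≤
      (bondPercolation G p).real ((T k)ᶜ ∩ (B k)ᶜ) := fun k => by
    rw [← probReal_compl_eq_one_sub (hTm k), ← probReal_compl_eq_one_sub (hBm k)]
    exact harris_fkg_lower G p (hT k).compl (hB k).compl (hTm k).compl (hBm k).compl
  have h2 : {ω : BondConfig V | ∀ k, ω ∉ T k ∧ ω ∉ B k} =
      ⋂ k ∈ (Finset.univ : Finset κ), ((T k)ᶜ ∩ (B k)ᶜ) := by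
    ext ω
    simp only [Set.mem_setOf_eq, Finset.mem_univ, Set.iInter_true, Set.mem_iInter,
      Set.mem_inter_iff, Set.mem_compl_iff]
  rw [h2]
  refine le_trans (Finset.prod_le_prod (fun k _ => mul_nonneg (sub_nonneg.2 measureReal_le_one)
    (sub_nonneg.2 measureReal_le_one)) fun k _ => h1 k) ?_
  exact sixWalls_prod_real_le_biInter G p Finset.univ
    (fun k _ => (hT k).compl.inter (hB k).compl) fun k _ => (hTm k).compl.inter (hBm k).compl

/-- **A.e. monotonicity on lattice configurations**: if `A ⊆ B` on configurations `ω ⊆ E(G)`,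
then `P_p(A) ≤ P_p(B)` (`P_p`-a.e. `ω ⊆ E(G)`, via `real_preimage_inter_edgeSet`). -/
theorem sixWalls_real_mono_of_subset_edgeSet [Countable V] (G : SimpleGraph V) (p : unitInterval)
    {A B : Set (BondConfig V)} (h : ∀ ω ⊆ G.edgeSet, ω ∈ A → ω ∈ B) :
    (bondPercolation G p).real A ≤ (bondPercolation G p).real B := by
  rw [← real_preimage_inter_edgeSet G p A, ← real_preimage_inter_edgeSet G p B]
  exact measureReal_mono (fun ω hω => h _ Set.inter_subset_right hω) (measure_ne_top _ _)

/-! ### The wall-crossing events -/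

/-- A wall-crossing event `{∃ x y, x ∈ R, y ∈ R, P x, Q y, x ↔ y in S}` is increasing. -/
theorem sixWalls_isUpperSet_crossing (R S : Set V) (P Q : V → Prop) :
    IsUpperSet {ω : BondConfig V | ∃ x y : V, x ∈ R ∧ y ∈ R ∧ P x ∧ Q y ∧ ω ∈ openConnIn S x y} := by
  rintro ω ω' hle ⟨x, y, hx, hy, hP, hQ, hω⟩
  exact ⟨x, y, hx, hy, hP, hQ, isUpperSet_openConnIn S x y hle hω⟩

/-- A wall-crossing event `{∃ x y, x ∈ R, y ∈ R, P x, Q y, x ↔ y in S}` is measurable (a countable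
union of the measurable events `{x ↔ y in S}`). -/
theorem sixWalls_measurableSet_crossing [Countable V] (R S : Set V) (P Q : V → Prop) :
    MeasurableSet
      {ω : BondConfig V | ∃ x y : V, x ∈ R ∧ y ∈ R ∧ P x ∧ Q y ∧ ω ∈ openConnIn S x y} := by
  have h : {ω : BondConfig V | ∃ x y : V, x ∈ R ∧ y ∈ R ∧ P x ∧ Q y ∧ ω ∈ openConnIn S x y} =
      ⋃ x : V, ⋃ y : V, ⋃ (_ : x ∈ R ∧ y ∈ R ∧ P x ∧ Q y), openConnIn S x y := by
    ext ω
    simp only [Set.mem_setOf_eq, Set.mem_iUnion, exists_prop, and_assoc]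
  rw [h]
  exact MeasurableSet.iUnion fun x => MeasurableSet.iUnion fun y =>
    MeasurableSet.iUnion fun _ => restrictProduct_measurableSet_openConnIn S x y

/-! ### Lattice geometry of `ℤ^d` -/

/-- Each coordinate is `1`-Lipschitz along the edges of `ℤ^d` (`zdGraph_adj_apply_le`). -/
theorem sixWalls_apply_le_of_adj {d : ℕ} (i : Fin d) :
    ∀ u v : Site d, (zdGraph d).Adj u v → v i ≤ u i + 1 :=
  fun _ _ h => (zdGraph_adj_apply_le h i).1

/-! ### The pointwise heart: an annulus crossing crosses one of the six walls -/

/-- **Kesten's six walls, pointwise.** On a lattice configuration `ω ⊆ E(ℤ³)`, an open path of the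
annulus `Icc lo' hi' ∖ Icc lo hi` from a vertex `u` adjacent to the inner box to a vertex `w`
adjacent to the outside of the outer box crosses, in its thin direction, the top or the bottom
wall in some coordinate direction `i`: `w` lies on a face `{zᵢ = hi' i}` or `{zᵢ = lo' i}` of the
outer box, and the piece of the path after its last visit to the level `{zᵢ = hi i + 1}`
(resp. `{zᵢ = lo i - 1}`) stays inside the wall. -/
theorem sixWalls_crossing_of_openConnIn {lo hi lo' hi' : Site 3} (hlo : ∀ i, lo' i < lo i)
    (hhi : ∀ i, hi i < hi' i) {ω : BondConfig (Site 3)} (hω : ω ⊆ (zdGraph 3).edgeSet)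
    {u w : Site 3} (hu : ∃ z ∈ Set.Icc lo hi, (zdGraph 3).Adj u z)
    (hw : ∃ z ∉ Set.Icc lo' hi', (zdGraph 3).Adj w z)
    (h : ω ∈ openConnIn (Set.Icc lo' hi' \ Set.Icc lo hi) u w) :
    ∃ i : Fin 3,
      (∃ x y : Site 3, x ∈ Set.Icc lo' hi' ∧ y ∈ Set.Icc lo' hi' ∧ x i = hi i + 1 ∧ y i = hi' i ∧
          ω ∈ openConnIn (Set.Icc lo' hi' ∩ {z | hi i + 1 ≤ z i}) x y) ∨
        (∃ x y : Site 3, x ∈ Set.Icc lo' hi' ∧ y ∈ Set.Icc lo' hi' ∧ x i = lo i - 1 ∧ y i = lo' i ∧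
          ω ∈ openConnIn (Set.Icc lo' hi' ∩ {z | z i ≤ lo i - 1}) x y) := by
  obtain ⟨z, hz, huz⟩ := hu
  obtain ⟨z', hz', hwz'⟩ := hw
  have hwR : w ∈ Set.Icc lo' hi' := h.2.1.1
  have hwR' := hwR
  simp only [Set.mem_Icc, Pi.le_def] at hz hwR'
  -- `z' ∉ R'`: some coordinate of `z'` is out of range
  have hz'out : ∃ i, z' i < lo' i ∨ hi' i < z' i := by
    simp only [Set.mem_Icc, Pi.le_def, not_and_or, not_forall, not_le] at hz'
    rcases hz' with ⟨i, hi⟩ | ⟨i, hi⟩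
    exacts [⟨i, Or.inl hi⟩, ⟨i, Or.inr hi⟩]
  obtain ⟨i, hzi | hzi⟩ := hz'out
  · -- bottom wall in direction `i`: `w i = lo' i`
    have hwi : w i = lo' i := by
      have h1 := zdGraph_adj_apply_le hwz' i
      have h2 := (hwR'.1) i
      omega
    have hui : lo i - 1 ≤ u i := by
      have h1 := zdGraph_adj_apply_le huz i
      have h2 := hz.1 i
      omega
    refine ⟨i, Or.inr ?_⟩
    rw [openConnIn_comm] at h
    obtain ⟨x, hx, hconn⟩ := exists_openConnIn_le_level hω (fun v : Site 3 => v i)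
      (sixWalls_apply_le_of_adj i) (lo i - 1) (by have h3 := hlo i; change w i ≤ lo i - 1; omega)
      hui h
    rw [openConnIn_comm] at hconn
    have hsub : (Set.Icc lo' hi' \ Set.Icc lo hi) ∩ {v : Site 3 | v i ≤ lo i - 1} ⊆
        Set.Icc lo' hi' ∩ {v : Site 3 | v i ≤ lo i - 1} := fun v hv => ⟨hv.1.1, hv.2⟩
    exact ⟨x, w, hconn.1.1.1, hwR, hx, hwi, openConnIn_mono hsub x w hconn⟩
  · -- top wall in direction `i`: `w i = hi' i`
    have hwi : w i = hi' i := by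
      have h1 := zdGraph_adj_apply_le hwz' i
      have h2 := (hwR'.2) i
      omega
    have hui : u i ≤ hi i + 1 := by
      have h1 := zdGraph_adj_apply_le huz i
      have h2 := hz.2 i
      omega
    refine ⟨i, Or.inl ?_⟩
    obtain ⟨x, hx, hconn⟩ := exists_openConnIn_ge_level hω (fun v : Site 3 => v i)
      (sixWalls_apply_le_of_adj i) (hi i + 1) hui
      (by have h3 := hhi i; change hi i + 1 ≤ w i; omega) h
    have hsub : (Set.Icc lo' hi' \ Set.Icc lo hi) ∩ {v : Site 3 | hi i + 1 ≤ v i} ⊆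
        Set.Icc lo' hi' ∩ {v : Site 3 | hi i + 1 ≤ v i} := fun v hv => ⟨hv.1.1, hv.2⟩
    exact ⟨x, w, hconn.1.1.1, hwR, hx, hwi, openConnIn_mono hsub x w hconn⟩

/-! ### The stub -/

/-- **S7 — Kesten's six walls.** For boxes `R = Icc lo hi ⊆ R' = Icc lo' hi'` of `ℤ³` with
`lo' < lo` and `hi < hi'` coordinatewise, under `P = bondPercolation (zdGraph 3) p` (every `p`):
`∏ᵢ (1 - P(top wall i crossed)) (1 - P(bottom wall i crossed)) ≤ P(Shell(R, R'))`, where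
`Shell(R, R')` = no open path of `R' ∖ R` from a vertex adjacent to `R` to a vertex adjacent to
`R'ᶜ`, the top wall in direction `i` is `R' ∩ {hi i + 1 ≤ zᵢ}` crossed from `{zᵢ = hi i + 1}` to
`{zᵢ = hi' i}`, and the bottom wall is `R' ∩ {zᵢ ≤ lo i - 1}` crossed from `{zᵢ = lo i - 1}` to
`{zᵢ = lo' i}`. Harris–FKG for the six decreasing non-crossing events, and, a.e. on lattice
configurations, `⋂ (non-crossing) ⊆ Shell` (`sixWalls_crossing_of_openConnIn`). -/
theorem stub_shellOfSixWalls (p : unitInterval) (lo hi lo' hi' : Site 3) (hlo : ∀ i, lo' i < lo i)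
    (hhi : ∀ i, hi i < hi' i) :
    (∏ i : Fin 3,
        ((1 - (bondPercolation (zdGraph 3) p).real
            {ω | ∃ x y : Site 3, x ∈ Set.Icc lo' hi' ∧ y ∈ Set.Icc lo' hi' ∧ x i = hi i + 1 ∧ y i = hi' i ∧
              ω ∈ openConnIn (Set.Icc lo' hi' ∩ {z | hi i + 1 ≤ z i}) x y}) *
          (1 - (bondPercolation (zdGraph 3) p).real
            {ω | ∃ x y : Site 3, x ∈ Set.Icc lo' hi' ∧ y ∈ Set.Icc lo' hi' ∧ x i = lo i - 1 ∧ y i = lo' i ∧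
              ω ∈ openConnIn (Set.Icc lo' hi' ∩ {z | z i ≤ lo i - 1}) x y}))) ≤
      (bondPercolation (zdGraph 3) p).real
        {ω | ∀ u ∈ Set.Icc lo' hi' \ Set.Icc lo hi, ∀ w ∈ Set.Icc lo' hi' \ Set.Icc lo hi,
          (∃ z ∈ Set.Icc lo hi, (zdGraph 3).Adj u z) → (∃ z ∉ Set.Icc lo' hi', (zdGraph 3).Adj w z) →
          ω ∉ openConnIn (Set.Icc lo' hi' \ Set.Icc lo hi) u w} := by
  refine le_trans (sixWalls_prod_one_sub_mul_le (zdGraph 3) p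
    (T := fun i => {ω | ∃ x y : Site 3, x ∈ Set.Icc lo' hi' ∧ y ∈ Set.Icc lo' hi' ∧
      x i = hi i + 1 ∧ y i = hi' i ∧ ω ∈ openConnIn (Set.Icc lo' hi' ∩ {z | hi i + 1 ≤ z i}) x y})
    (B := fun i => {ω | ∃ x y : Site 3, x ∈ Set.Icc lo' hi' ∧ y ∈ Set.Icc lo' hi' ∧
      x i = lo i - 1 ∧ y i = lo' i ∧ ω ∈ openConnIn (Set.Icc lo' hi' ∩ {z | z i ≤ lo i - 1}) x y})
    (fun i => sixWalls_isUpperSet_crossing _ _ _ _) (fun i => sixWalls_isUpperSet_crossing _ _ _ _)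
    (fun i => sixWalls_measurableSet_crossing _ _ _ _)
    (fun i => sixWalls_measurableSet_crossing _ _ _ _)) ?_
  refine sixWalls_real_mono_of_subset_edgeSet (zdGraph 3) p fun ω hω hmem => ?_
  intro u _ w _ hu hw hconn
  obtain ⟨i, hT | hB⟩ := sixWalls_crossing_of_openConnIn hlo hhi hω hu hw hconn
  · exact (hmem i).1 hT
  · exact (hmem i).2 hB

end Summit.CriticalPhenomena.PercolationContinuityZ3.Theorems.TetrahedronDisjointCoexistence

end
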